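import Mathlib.RingTheory.Derivation.Basic
import Mathlib.RingTheory.Adjoin.Basic
import Mathlib.Algebra.Algebra.Subalgebra.Lattice
import Mathlib.Tactic.FieldSimp
import Mathlib.Tactic.Ring
import HarnessLib

/-!
# Logarithmic derivations extend to the charts of a point blow-up (Giraud 1983, 1.6)

Route `ResolutionOfSingularities/RadicialJung`, crux `CleanModels` (stmt-ResolutionOfSingularities-15917),
line `via-clean-models` of crux `DescentPerfectToAll` (stmt-ResolutionOfSingularities-0549): brick
K3c-ii of PROGRAMME-clean-dim2 (Giraud's normal form over an ARBITRARY ground field; companion of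
res-L0-w81-pv-1's K2 files `RadicialJungCleanModelsGiraudTotalColength.lean`, which work with the
charts `R[y/x] ⊆ K` of the blow-up of a regular local ring `R ⊆ K`). Helper file (`--supports`), OURS;
nothing here is a statement of Hironaka's manuscript.

Giraud (Bull. SMF 111 (1983), Remarque 1.6, p. 114, formulas (2)–(4)): for the blow-up
`e : X' → X` of a centre which is combinatorial for the normal-crossings divisor `E`, the pulled
back boundary `e⁻¹(E)` is again a normal-crossings divisor, `e^*(Ω¹_X(E)) ⊆ Ω¹_{X'}(e⁻¹ E)`
(`dx_i/x_i = du_i/u_i`, `dx_j/x_j = du_j/u_j + du_i/u_i` on the chart `x_j = u_j x_i`), and hence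
`J(X, f, E) 𝒪_{X'} ⊆ J(X', f ∘ e, e⁻¹(E))` for the log-Jacobian content ideals. In the Ω-free
language the tree uses over arbitrary fields (content ideals = values of derivations,
`RadicialJungCleanModelsContentIdeal.lean`), this is a statement about DERIVATIONS of the function
field `K`: a derivation `D` of `K` which preserves `R` and is LOGARITHMIC along `x` and `y`
(`D x ∈ x R`, `D y ∈ y R`)
* preserves the chart algebra `R[y/x]` (`derivation_mapsTo_adjoin_div_of_log`), and
* is logarithmic there along the new boundary `x` (exceptional) and `y/x` (strict transform):
  `D (y/x) = (b - a) · (y/x)` when `D x = a x`, `D y = b y` (`derivation_apply_div_eq_of_log`);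
* consequently (`logDerivationValues_subset_chart`) every value `D f` of an `(x, y)`-logarithmic
  derivation of `R` is a value of an `(x, y/x)`-logarithmic derivation of `R[y/x]`: Giraud's
  inclusion `J(X, f, E) 𝒪_{X'} ⊆ J(X', f, E')`, 1.6 (4), generator by generator.
General tool: a derivation preserving `R` and mapping each generator of `Algebra.adjoin R s` into
`Algebra.adjoin R s` preserves `Algebra.adjoin R s` (`derivation_mapsTo_adjoin`, Leibniz).

## References
* J. Giraud, *Forme normale d'une fonction sur une surface de caractéristique positive*, Bull. Soc.
  Math. France 111 (1983), Remarque 1.6 (2)–(4). [Giraud1983]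
-/

noncomputable section

set_option linter.dupNamespace false -- mandated namespace of this single-conjunct summit

namespace Summit.ResolutionOfSingularities.ResolutionOfSingularities.Theorems.RadicialJung.CleanModels

universe u

variable {K : Type u} [Field K]

/-- **Leibniz closure.** A derivation of `K` which maps a subring `R` into itself and each generator
`t ∈ s` into `Algebra.adjoin R s` maps `Algebra.adjoin R s` into itself. [folklore] -/
theorem derivation_mapsTo_adjoin {R : Subring K} (D : Derivation ℤ K K) (hD : ∀ r : R, D r ∈ R)
    {s : Set K} (hs : ∀ t ∈ s, D t ∈ Algebra.adjoin R s) :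
    ∀ z ∈ Algebra.adjoin R s, D z ∈ Algebra.adjoin R s := by
  intro z hz
  induction hz using Algebra.adjoin_induction with
  | mem t ht => exact hs t ht
  | algebraMap r =>
    exact Subalgebra.algebraMap_mem (Algebra.adjoin R s) ⟨D r, hD r⟩
  | add a b _ _ ha hb => rw [map_add]; exact add_mem ha hb
  | mul a b ha' hb' ha hb =>
    rw [Derivation.leibniz, smul_eq_mul, smul_eq_mul]
    exact add_mem (mul_mem ha' hb) (mul_mem hb' ha)

/-- **The log form of the chart variable** (Giraud 1.6 (3): `dx_j/x_j = du_j/u_j + du_i/u_i`): if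
`D x = a x` and `D y = b y` then `D (y/x) = (b - a) (y/x)`. [cite: Giraud1983, Rem. 1.6 (3)] -/
theorem derivation_apply_div_eq_of_log (D : Derivation ℤ K K) {x y a b : K} (hx : x ≠ 0)
    (hDx : D x = a * x) (hDy : D y = b * y) : D (y / x) = (b - a) * (y / x) := by
  rw [Derivation.leibniz_div, hDx, hDy, smul_eq_mul, smul_eq_mul, smul_eq_mul]
  field_simp

/-- **Logarithmic derivations preserve the blow-up chart** (Giraud 1.6 (2)–(3)): a derivation of
`K` preserving the subring `R` with `D x ∈ x R` and `D y ∈ y R` (`x ≠ 0`) maps the chart algebra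
`R[y/x]` into itself. [cite: Giraud1983, Rem. 1.6 (2)–(3)] -/
theorem derivation_mapsTo_adjoin_div_of_log {R : Subring K} (D : Derivation ℤ K K)
    (hD : ∀ r : R, D r ∈ R) {x y : R} (hx : (x : K) ≠ 0) {a b : R}
    (hDx : D x = a * x) (hDy : D y = b * y) :
    ∀ z ∈ Algebra.adjoin R {(y : K) / x}, D z ∈ Algebra.adjoin R {(y : K) / x} := by
  refine derivation_mapsTo_adjoin D hD fun t ht => ?_
  rw [Set.mem_singleton_iff] at ht
  subst ht
  rw [derivation_apply_div_eq_of_log D hx hDx hDy]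
  exact Subalgebra.mul_mem _
    (Subalgebra.sub_mem _ (Subalgebra.algebraMap_mem _ b) (Subalgebra.algebraMap_mem _ a))
    (Algebra.subset_adjoin (Set.mem_singleton _))

/-- **… and are logarithmic along the new boundary**: with `u = y/x` and `S = R[u]`, such a `D` has
`D x ∈ x S` and `D u ∈ u S` (coefficients `a` and `b - a`). [cite: Giraud1983, Rem. 1.6 (3)] -/
theorem derivation_log_chart_of_log {R : Subring K} (D : Derivation ℤ K K) {x y : R}
    (hx : (x : K) ≠ 0) {a b : R} (hDx : D x = a * x) (hDy : D y = b * y) :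
    (∃ c ∈ Algebra.adjoin R {(y : K) / x}, D x = c * x) ∧
      ∃ c ∈ Algebra.adjoin R {(y : K) / x}, D ((y : K) / x) = c * ((y : K) / x) :=
  ⟨⟨a, Subalgebra.algebraMap_mem _ a, hDx⟩,
    ⟨(b : K) - a,
      Subalgebra.sub_mem _ (Subalgebra.algebraMap_mem _ b) (Subalgebra.algebraMap_mem _ a),
      derivation_apply_div_eq_of_log D hx hDx hDy⟩⟩

/-- **Giraud 1.6 (4), generator by generator: `J(X, f, E) 𝒪_{X'} ⊆ J(X', f, E')`.** Every value
`D f` of a derivation of `K` that preserves `R` and is logarithmic along `x, y` is the value on `f`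
of a derivation that preserves the chart `S = R[y/x]` and is logarithmic along `x` and `y/x` — the
same `D`. Stated as an inclusion of the sets of values which generate the two log-Jacobian content
ideals. [cite: Giraud1983, Rem. 1.6 (4)] -/
theorem logDerivationValues_subset_chart {R : Subring K} {x y : R} (hx : (x : K) ≠ 0) (f : K) :
    {v : K | ∃ D : Derivation ℤ K K, (∀ r : R, D r ∈ R) ∧ (∃ a : R, D x = a * x) ∧
        (∃ b : R, D y = b * y) ∧ D f = v} ⊆
      {v : K | ∃ D : Derivation ℤ K K, (∀ z ∈ Algebra.adjoin R {(y : K) / x},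
          D z ∈ Algebra.adjoin R {(y : K) / x}) ∧
        (∃ c ∈ Algebra.adjoin R {(y : K) / x}, D x = c * x) ∧
        (∃ c ∈ Algebra.adjoin R {(y : K) / x}, D ((y : K) / x) = c * ((y : K) / x)) ∧ D f = v} := by
  rintro v ⟨D, hD, ⟨a, hDx⟩, ⟨b, hDy⟩, rfl⟩
  obtain ⟨h₁, h₂⟩ := derivation_log_chart_of_log D hx hDx hDy
  exact ⟨D, derivation_mapsTo_adjoin_div_of_log D hD hx hDx hDy, h₁, h₂, rfl⟩

/-- The other chart `R[x/y]`, by symmetry: `D` preserves `R[x/y]`, with `D y = b y` and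
`D (x/y) = (a - b)(x/y)`. [cite: Giraud1983, Rem. 1.6 (2)–(3)] -/
theorem derivation_mapsTo_adjoin_div_of_log' {R : Subring K} (D : Derivation ℤ K K)
    (hD : ∀ r : R, D r ∈ R) {x y : R} (hy : (y : K) ≠ 0) {a b : R}
    (hDx : D x = a * x) (hDy : D y = b * y) :
    (∀ z ∈ Algebra.adjoin R {(x : K) / y}, D z ∈ Algebra.adjoin R {(x : K) / y}) ∧
      D ((x : K) / y) = ((a : K) - b) * ((x : K) / y) :=
  ⟨derivation_mapsTo_adjoin_div_of_log D hD hy hDy hDx, derivation_apply_div_eq_of_log D hy hDy hDx⟩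

/-- Localisation inside `K`: a derivation preserving a subring `A` maps `a / s` (`a, s ∈ A`,
`s ≠ 0`) to `(s · D a - a · D s)/s²`, an element of the same shape with denominator `s²`; in
particular it preserves every subring of `K` consisting of the fractions with denominators in a
multiplicative subset of `A` (the local rings of the chart at its points). Recorded as the explicit
quotient rule. [folklore] -/
theorem derivation_apply_div_eq (D : Derivation ℤ K K) (a s : K) (hs : s ≠ 0) :
    D (a / s) = (s * D a - a * D s) / s ^ 2 := by
  rw [Derivation.leibniz_div, smul_eq_mul, smul_eq_mul, smul_eq_mul]
  field_simp

end Summit.ResolutionOfSingularities.ResolutionOfSingularities.Theorems.RadicialJung.CleanModels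

end
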